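/-
Copyright (c) 2026. All rights reserved.
Released under Apache 2.0 license as described in the file LICENSE.
Authors: abc-iut cell, seat abc-iut-L4-t10 (gen 4; geometric `EA` column of [AbsTopIII] Prop 4.2 (i) /
Cor 4.5 — campaign-L item R1.2: the `EA` of all finite étale covers of a twice-punctured plane).
-/
import Literature.AnabelianGeometry.AbsoluteAnabelian.ArchimedeanHolFieldFunctorGeometricOverIdRigidTripod
import HarnessLib

/-!
# [AbsTopIII] Prop 4.2 (i) and Cor 4.5 at the geometric `EA` of ALL finite étale covers of the
# thrice-punctured sphere `ℙ¹ ∖ {0, 1, ∞}` (and of any `ℂ ∖ {p, q}`) — UNCONDITIONAL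

S. Mochizuki, *Topics in Absolute Anabelian Geometry III*, proof of Prop 4.2 (i), kurims p.106 l.11–19
(lit key `paper:url-5493eb38cbb7`, read on the page; bib key `MochizukiAbsTopIII2015`): «for any
object `X` of `EA`, the full subcategory of `EA` consisting of objects that map to `X` may … be identified
with … `Loc_R(X)` … [and is id-rigid by] the slimness assertion of Lemma 4.3; thus, the id-rigidity of
`EA` follows»; Cor 4.5 pp.107–109.  PROOF-ONLY file (no definition).

State of the tree before this file.  For the geometric instance `EA^hol_RS(Q)` of the Cor 2.7 (e)
interface (abc-iut-L4-t14's `HolRS.geometricAutHolFieldFunctor Q`: connected Riemann surfaces with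
property `Q`, holomorphic finite étale maps), abc-iut-L4-t12's reduction and instances
(`ArchimedeanHolFieldFunctorGeometricOverIdRigid(Instances|Tripod).lean`) prove, with NO residual
hypothesis, that «objects of `EA^hol_RS(Q)` mapping to `ℂ ∖ F`» is id-rigid for every cover-closed `Q`
containing `ℂ ∖ F`, `|F| = 2` (`HolRS.isIdRigid_mapsTo_planeComplFinite_of_ncard_eq_two`: (H1) at the
tripod from the classification `Aut^hol(ℂ ∖ {0,1}) = 𝔖₃` and `Z(𝔖₃) = 1`, transported to `ℂ ∖ {p,q}`;
the slice half from `Z(F̂₂) = 1`, abc-iut-L6-t18 / -w5-d144).  That is a statement about a full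
SUBcategory of `EA`; print's «thus, the id-rigidity of `EA` follows» is obtained in the tree object by
object (abc-iut-L4-t14's `isIdRigid_EA_of_forall_isIdRigid_mapsTo`), which would need (H1) at EVERY
object of `Q` — false in general (abc-iut-w6-d003's VACUITY-H1: a once-punctured elliptic curve has a
central involution).

This file observes that for the SMALLEST cover-closed `Q` containing `ℂ ∖ F` — `Q_F :=` «admits a
holomorphic finite étale map to `ℂ ∖ F`» — every object maps to `ℂ ∖ F`, so the subcategory IS the whole
`EA^hol_RS(Q_F)` and no (H1) at any other object is needed:

* `isIdRigid_of_forall_nonempty_hom` — generic: if EVERY object of `C` maps to `X` and «objects mapping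
  to `X`» is id-rigid, then `C` is id-rigid; `HolRS.isCoverClosed_mapsTo`, `HolRS.isIdRigid_EA_mapsTo_of`
  — the same at `EA^hol_RS(Q_𝕏)` for any connected Riemann surface `𝕏`.
* `HolRS.isIdRigid_EA_planeComplPairCovers` — **`EA^hol_RS(Q_F)` IS ID-RIGID, ZERO residual hypotheses,
  for every `F ⊆ ℂ` with `|F| = 2`**; `HolRS.isIdRigid_EA_tripodCovers` — the thrice-punctured sphere
  `F = {0, 1}`.  The first GENUINE HYPERBOLIC families of the geometric model at which print's Prop 4.2
  (i) conclusion «`EA` is id-rigid» is a kernel theorem (earlier zero-binder instances: `{ℂ}`, `{ℂˣ}`,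
  `{𝔻}`, `{ℂ, ℂˣ, 𝔻}` — seats abc-iut-L4-t10 gen 3 / abc-iut-L4-t14).
* `HolRS.isIdRigid_pairs_planeComplPairCovers` / `…_tripodCovers` — Prop 4.2 (i), id-rigidity of
  `𝒞^hol_TF` and `𝒞^hol_T` over those `EA`, zero binders.
* `HolRS.cor_4_5_geometric_planeComplPairCovers` / **`HolRS.cor_4_5_geometric_tripodCovers`** —
  **[AbsTopIII] Cor 4.5 (i)–(v) AS TYPED hold OUTRIGHT for the archimedean log-Frobenius data over the
  geometric `EA` of all finite étale covers of `ℂ ∖ {p, q}`, in particular of `ℙ¹ ∖ {0, 1, ∞}`** (seat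
  abc-iut-L4-t10's `cor_4_5_geometric`).

HONEST SCOPE: model-level (the geometric instance of the interface; `𝒜_𝕏 = ℂ`), not the printed `EA`
of ALL elliptically admissible hyperbolic orbicurves (orbi-objects, the general-`X` descent «H1PRIME»
of abc-iut-w6-d003 / -w5-d144, and print's uniformisation route via Lemma 4.3 on the core are other
rows); node `AbsTopIII:Cor4.5` is not a counting node.  Refereed pre-IUT anabelian geometry and
classical complex analysis; nothing here bears on [IUTchIII] Cor. 3.12 or takes a side; typed ≠ proved.
-/

noncomputable section

open CategoryTheory Set Topology TopologicalSpace
open scoped Manifold ContDiff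
open Literature.Topology.CoveringSpaces

namespace Literature.AnabelianGeometry.AbsoluteAnabelian

universe v u

/-! ### §1 Generic: id-rigidity from «objects mapping to `X`» when everything maps to `X` -/

/-- **If every object of `C` maps to `X` and the full subcategory «objects mapping to `X`» is id-rigid,
then `C` is id-rigid**: an automorphism `α` of `𝟭_C` restricts to an automorphism of the identity
functor of `{Y | Nonempty (Y ⟶ X)}` with the same components, which are therefore identities.
[cite: MochizukiAbsTopIII2015, Proposition 4.2 (i) p.106] -/
theorem isIdRigid_of_forall_nonempty_hom {C : Type u} [Category.{v} C] (X : C)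
    (hall : ∀ Y : C, Nonempty (Y ⟶ X))
    (h : IsIdRigid (ObjectProperty.FullSubcategory fun Y : C => Nonempty (Y ⟶ X))) :
    IsIdRigid C := by
  refine isRigidFunctor_of_hom_app_eq_id fun α Y => ?_
  let P : ObjectProperty C := fun Y : C => Nonempty (Y ⟶ X)
  let β : 𝟭 P.FullSubcategory ≅ 𝟭 P.FullSubcategory :=
    NatIso.ofComponents (fun Z => P.isoMk (α.app Z.obj)) (fun {Z Z'} f => by
      apply ObjectProperty.hom_ext
      have hn := α.hom.naturality f.hom
      simp only [Functor.id_obj, Functor.id_map] at hn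
      simpa using hn)
  have hβ := h.hom_app_eq_id β ⟨Y, hall Y⟩
  have hβ' := congrArg InducedCategory.Hom.hom hβ
  simpa [β] using hβ'

namespace HolRS

/-! ### §2 The geometric `EA` of everything finite étale over one connected Riemann surface `𝕏` -/

/-- The object property «admits a holomorphic finite étale map to `𝕏`» is closed under finite étale
covers (compose). [cite: MochizukiAbsTopIII2015, Definition 4.1 (iii) p.103] -/
theorem isCoverClosed_mapsTo (X : HolRS) : IsCoverClosed (fun Y : HolRS => Nonempty (Y ⟶ X)) :=
  fun f hZ => hZ.map fun g => f ≫ g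

/-- **`EA^hol_RS(Q_𝕏)` is id-rigid as soon as «objects mapping to `𝕏`» (inside it) is**, for
`Q_𝕏 :=` «admits a holomorphic finite étale map to `𝕏`»: every object maps to `𝕏`.
[cite: MochizukiAbsTopIII2015, Proposition 4.2 (i) p.106] -/
theorem isIdRigid_EA_mapsTo_of (X : HolRS)
    (h : IsIdRigid (ObjectProperty.FullSubcategory fun Y :
      ObjectProperty.FullSubcategory (fun Y : HolRS => Nonempty (Y ⟶ X)) =>
        Nonempty (Y ⟶ ⟨X, ⟨𝟙 X⟩⟩))) :
    IsIdRigid (geometricAutHolFieldFunctor (fun Y : HolRS => Nonempty (Y ⟶ X))).EA :=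
  isIdRigid_of_forall_nonempty_hom
    (C := ObjectProperty.FullSubcategory (fun Y : HolRS => Nonempty (Y ⟶ X))) ⟨X, ⟨𝟙 X⟩⟩
    (fun Y => Y.property.map ObjectProperty.homMk) h

/-! ### §3 Every twice-punctured plane `ℂ ∖ {p, q}`: unconditional -/

/-- **`EA^hol_RS(Q_F)` is id-rigid with NO residual hypothesis, for every `F ⊆ ℂ` with exactly two
elements and `Q_F :=` «admits a holomorphic finite étale map to `ℂ ∖ F`»**: every automorphism of the
identity functor of the category of connected Riemann surfaces finite étale over `ℂ ∖ F` — with ALL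
holomorphic finite étale maps between them as morphisms, not only those over `ℂ ∖ F` — is trivial
(abc-iut-L4-t12's `isIdRigid_mapsTo_planeComplFinite_of_ncard_eq_two` lifted by
`isIdRigid_EA_mapsTo_of`). [cite: MochizukiAbsTopIII2015, Proposition 4.2 (i) p.106] -/
theorem isIdRigid_EA_planeComplPairCovers {F : Set ℂ} (hF : F.Finite) (h2 : F.ncard = 2) :
    IsIdRigid (geometricAutHolFieldFunctor (fun Y : HolRS =>
      Nonempty (Y ⟶ planeComplFinite F hF))).EA :=
  isIdRigid_EA_mapsTo_of _
    (isIdRigid_mapsTo_planeComplFinite_of_ncard_eq_two _ (isCoverClosed_mapsTo _) hF h2 ⟨𝟙 _⟩)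

/-- **Prop 4.2 (i), id-rigidity of `𝒞^hol_TF` and of `𝒞^hol_T` (`T ∈ {TM, TLG, TCG}`), OUTRIGHT over the
finite étale covers of `ℂ ∖ {p, q}`.** [cite: MochizukiAbsTopIII2015, Proposition 4.2 (i) p.105] -/
theorem isIdRigid_pairs_planeComplPairCovers {F : Set ℂ} (hF : F.Finite) (h2 : F.ncard = 2)
    {T : ArchPairType} (hT : T.IsMonoidType) :
    IsIdRigid (HolTFPair (geometricAutHolFieldFunctor (fun Y : HolRS =>
      Nonempty (Y ⟶ planeComplFinite F hF)))) ∧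
    IsIdRigid (HolMonoidPair (geometricAutHolFieldFunctor (fun Y : HolRS =>
      Nonempty (Y ⟶ planeComplFinite F hF))) T) :=
  isIdRigid_pairs_of_isIdRigid_EA _ (isIdRigid_EA_planeComplPairCovers hF h2) hT

/-- **[AbsTopIII] Cor 4.5 (i)–(v) AS TYPED hold OUTRIGHT for the archimedean log-Frobenius data over the
geometric `EA` of all finite étale covers of `ℂ ∖ {p, q}`** — object `𝕏₀ := ℂ ∖ {p, q}` itself,
id-rigidity `isIdRigid_EA_planeComplPairCovers`, through seat abc-iut-L4-t10's `cor_4_5_geometric`.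
[cite: MochizukiAbsTopIII2015, Corollary 4.5 pp.107–109] -/
theorem cor_4_5_geometric_planeComplPairCovers {F : Set ℂ} (hF : F.Finite) (h2 : F.ncard = 2) :
    AbsTopIII.Cor_4_5
      (archLogFrobeniusData (geometricAutHolFieldFunctor (fun Y : HolRS =>
        Nonempty (Y ⟶ planeComplFinite F hF))))
      (archTelecoreData (geometricAutHolFieldFunctor (fun Y : HolRS =>
        Nonempty (Y ⟶ planeComplFinite F hF)))) :=
  cor_4_5_geometric _ ⟨planeComplFinite F hF, ⟨𝟙 _⟩⟩ (isIdRigid_EA_planeComplPairCovers hF h2)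

/-! ### §4 The thrice-punctured sphere `ℙ¹ ∖ {0, 1, ∞} = ℂ ∖ {0, 1}` -/

/-- **`EA^hol_RS` of all finite étale covers of the thrice-punctured sphere is id-rigid, ZERO binders.**
[cite: MochizukiAbsTopIII2015, Proposition 4.2 (i) p.106] -/
theorem isIdRigid_EA_tripodCovers :
    IsIdRigid (geometricAutHolFieldFunctor (fun Y : HolRS =>
      Nonempty (Y ⟶ planeComplFinite ({0, 1} : Set ℂ) (Set.toFinite _)))).EA :=
  isIdRigid_EA_planeComplPairCovers (Set.toFinite _) (Set.ncard_pair (zero_ne_one' ℂ))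

/-- **Prop 4.2 (i), id-rigidity of `𝒞^hol_TF` and of `𝒞^hol_T`, OUTRIGHT over the finite étale covers of
the thrice-punctured sphere.** [cite: MochizukiAbsTopIII2015, Proposition 4.2 (i) p.105] -/
theorem isIdRigid_pairs_tripodCovers {T : ArchPairType} (hT : T.IsMonoidType) :
    IsIdRigid (HolTFPair (geometricAutHolFieldFunctor (fun Y : HolRS =>
      Nonempty (Y ⟶ planeComplFinite ({0, 1} : Set ℂ) (Set.toFinite _))))) ∧
    IsIdRigid (HolMonoidPair (geometricAutHolFieldFunctor (fun Y : HolRS =>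
      Nonempty (Y ⟶ planeComplFinite ({0, 1} : Set ℂ) (Set.toFinite _)))) T) :=
  isIdRigid_pairs_planeComplPairCovers (Set.toFinite _) (Set.ncard_pair (zero_ne_one' ℂ)) hT

/-- **[AbsTopIII] Cor 4.5 (i)–(v) AS TYPED hold OUTRIGHT for the archimedean log-Frobenius data over the
geometric `EA` of all finite étale covers of `ℙ¹ ∖ {0, 1, ∞}`.**
[cite: MochizukiAbsTopIII2015, Corollary 4.5 pp.107–109] -/
theorem cor_4_5_geometric_tripodCovers :
    AbsTopIII.Cor_4_5
      (archLogFrobeniusData (geometricAutHolFieldFunctor (fun Y : HolRS =>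
        Nonempty (Y ⟶ planeComplFinite ({0, 1} : Set ℂ) (Set.toFinite _)))))
      (archTelecoreData (geometricAutHolFieldFunctor (fun Y : HolRS =>
        Nonempty (Y ⟶ planeComplFinite ({0, 1} : Set ℂ) (Set.toFinite _))))) :=
  cor_4_5_geometric_planeComplPairCovers (Set.toFinite _) (Set.ncard_pair (zero_ne_one' ℂ))

end HolRS

end Literature.AnabelianGeometry.AbsoluteAnabelian
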